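import Summits.CriticalPhenomena.PercolationContinuityZ3.Theorems.FreeBoxPowerSaving.Negative.FreeBoxPowerSavingProfile
import Literature.Barriers.CriticalPhenomena.LaceExpansionHighDimensionOneArm
import Literature.Barriers.CriticalPhenomena.LaceExpansionHighDimensionProofs
import Literature.Barriers.CriticalPhenomena.KozmaNachmiasLemma31

/-!
# Negative / tightness lemmas for the crux `FreeBoxPowerSaving` (stmt-CriticalPhenomena-4447), IV:
# the one-arm reduction and what a refutation entails

For `FA₂(p, n) = fa2 p n = |B(n)|⁻² Σ_{x,y∈B(n)} P_p(x ↔ y in B(n))` on `ℤ³` (parts I–III: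
`FreeBoxPowerSavingBounds.lean`, `FreeBoxPowerSavingProfile.lean`) and the one-arm probability
`π_p(m) = oneArmProb 3 p m = P_p(0 ↔ ∂Λ_m)`.  Landed from the standing disprover's work file
`Cruxes/FreeBoxPowerSaving/Disproof.lean` §8 (cycle 2); sorry-free; nothing here closes the crux.

* `sum_tau_box_le_of_oneArm_rpow` — a one-arm bound `π_p(m) ≤ C m^{-s}` (`m ≥ 1`, `0 < s ≤ 1`) gives
  `Σ_{z ∈ B(n)} τ_p(0, z) ≤ (125 + 864 C²) n^{3-2s}` (two disjoint boxes, tree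
  `tau_le_oneArmProb_sq_of_coord`, summed over the shells `∂Λ_k`, `|∂Λ_k| ≤ 54 k²`), whence
  `fa2_le_of_oneArm` — `FA₂(p, n) ≤ 8 (125 + 864 C²) n^{-2s}` for `n ≥ 1`: polynomial one-arm decay at
  `p_c` gives the crux with exponent `a = 2s` (`of_oneArm_decay`; the predicted `s = β/ν ≈ 0.477` makes
  this the sharp `a = 1 + η ≈ 0.954`).
* `forall_exists_oneArmProb_gt_of_not` — WHAT A REFUTATION ENTAILS: `¬ FreeBoxPowerSaving` forces the
  critical one-arm probability of `ℤ³` to decay slower than every power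
  (`∀ s > 0, ∀ C, ∃ m ≥ 1, π_{p_c}(m) > C m^{-s}`) — next door to `θ(p_c) > 0`, and out of reach of
  every known technique in either direction (not even `π_{p_c}(m) → 0` is known on `ℤ³`).
* `oneArmProb_criticalProbI_ge` — the classical floor `π_{p_c}(m) ≥ 1/(6(4m+3))` (order `m^{-(d-1)/2}`
  at `d = 3`: the Kozma–Nachmias Lemma 3.1 sphere sum `≥ 1/6` over `|∂Λ_{2m+1}| ≤ 6(4m+3)²` terms each
  `≤ π_{p_c}(m)²`), and `oneArm_exponent_le_one` — so a one-arm exponent at `p_c` is `≤ 1` and the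
  one-arm route never beats the ceiling `a ≤ 2` of `Theorems/FreeBoxSparse/Negative/DCTFloor.lean`.
-/

namespace Summit.CriticalPhenomena.PercolationContinuityZ3.FreeBoxPowerSavingNegative

open MeasureTheory ProbabilityTheory Filter
open Literature.Probability.Percolation Literature.Probability.LatticeModels
open Literature.Barriers.CriticalPhenomena (tau_le_oneArmProb_sq_of_coord sum_box_sdiff_box_eq_sum_Ico
  card_sphere_succ_le' sum_sphere_real_openConnIn_ge)
open Summit.CriticalPhenomena.PercolationContinuityZ3.Theses.PercNonProliferation
open scoped BigOperators Topology

noncomputable section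

/-! ## From row sums to the bulk two-point box sum -/

/-- `Σ_{y ∈ B(n)} P_p(x ↔ y in B(n)) ≤ Σ_{z ∈ B(2n)} τ_p(0, z)` for `x ∈ B(n)`. [folklore] -/
theorem rowSum_le_sum_tau (p : unitInterval) {n : ℕ} {x : Site 3} (hx : x ∈ box 3 n) :
    ∑ y ∈ box 3 n, (bondPercolation (zdGraph 3) p).real (openConnIn (↑(box 3 n) : Set (Site 3)) x y)
      ≤ ∑ z ∈ box 3 (2 * n), tau 3 p 0 z := by
  have himg : (box 3 n).image (fun y => y - x) ⊆ box 3 (2 * n) := by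
    intro z hz
    obtain ⟨y, hy, rfl⟩ := Finset.mem_image.1 hz
    rw [mem_box] at hx hy ⊢
    intro i
    have h1 := hx i
    have h2 := hy i
    simp only [Pi.sub_apply]
    push_cast
    constructor <;> omega
  calc ∑ y ∈ box 3 n, (bondPercolation (zdGraph 3) p).real (openConnIn (↑(box 3 n) : Set (Site 3)) x y)
      ≤ ∑ y ∈ box 3 n, tau 3 p 0 (y - x) :=
        Finset.sum_le_sum fun y _ =>
          (real_openConnIn_le_tau p _ x y).trans_eq (tau_eq_tau_zero_sub p x y)
    _ = ∑ z ∈ (box 3 n).image (fun y => y - x), tau 3 p 0 z := by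
        rw [Finset.sum_image fun a _ b _ h => sub_left_injective h]
    _ ≤ ∑ z ∈ box 3 (2 * n), tau 3 p 0 z :=
        Finset.sum_le_sum_of_subset_of_nonneg himg fun z _ _ => tau_nonneg p 0 z

/-- `S_p(n) ≤ |B(n)| · Σ_{z ∈ B(2n)} τ_p(0, z)`. [folklore] -/
theorem pairSum_le_card_mul_sum_tau (p : unitInterval) (n : ℕ) :
    pairSum p n ≤ ((box 3 n).card : ℝ) * ∑ z ∈ box 3 (2 * n), tau 3 p 0 z := by
  unfold pairSum
  calc _ ≤ ∑ _x ∈ box 3 n, ∑ z ∈ box 3 (2 * n), tau 3 p 0 z :=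
        Finset.sum_le_sum fun x hx => rowSum_le_sum_tau p hx
    _ = _ := by rw [Finset.sum_const, nsmul_eq_mul]

/-! ## Shell summation under a one-arm bound -/

/-- **Shell summation**: `π_p(m) ≤ C m^{-s}` for `m ≥ 1` with `0 < s ≤ 1` gives
`Σ_{z ∈ B(n)} τ_p(0, z) ≤ (125 + 864 C²) n^{3-2s}` for `n ≥ 1` (two disjoint boxes on the annulus
`B(n) ∖ B(2)`: `τ_p(0, z) ≤ π_p(⌊(‖z‖_∞-1)/2⌋)² ≤ 16 C² ‖z‖_∞^{-2s}`; `τ ≤ 1` on `B(2)`).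
(Cf. `sum_tau_box_le_of_oneArm_upper`, the case `s = 2` of the barrier file.) [folklore] -/
theorem sum_tau_box_le_of_oneArm_rpow (p : unitInterval) {C s : ℝ} (hs0 : 0 < s) (hs1 : s ≤ 1)
    (hC : ∀ m : ℕ, 1 ≤ m → oneArmProb 3 p m ≤ C * (m : ℝ) ^ (-s)) {n : ℕ} (hn : 1 ≤ n) :
    ∑ z ∈ box 3 n, tau 3 p 0 z ≤ (125 + 864 * C ^ 2) * (n : ℝ) ^ (3 - 2 * s) := by
  classical
  have hn1 : (1 : ℝ) ≤ n := by exact_mod_cast hn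
  have hn0 : (0 : ℝ) < n := by linarith
  have hnpow1 : 1 ≤ (n : ℝ) ^ (3 - 2 * s) := Real.one_le_rpow hn1 (by linarith)
  have hC2 : 0 ≤ C ^ 2 := sq_nonneg C
  have hsmall : ∀ m : ℕ, m ≤ 2 → ∑ x ∈ box 3 m, tau 3 p 0 x ≤ 125 := by
    intro m hm
    calc ∑ x ∈ box 3 m, tau 3 p 0 x ≤ ∑ x ∈ box 3 2, tau 3 p 0 x :=
          Finset.sum_le_sum_of_subset_of_nonneg (box_mono 3 hm) fun x _ _ => tau_nonneg p 0 x
      _ ≤ ∑ _x ∈ box 3 2, (1 : ℝ) := Finset.sum_le_sum fun x _ => tau_le_one p 0 x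
      _ = 125 := by rw [Finset.sum_const, card_box, nsmul_eq_mul, mul_one]; norm_num
  rcases le_or_gt n 2 with hn2 | hn2
  · calc ∑ x ∈ box 3 n, tau 3 p 0 x ≤ 125 := hsmall n hn2
      _ ≤ (125 + 864 * C ^ 2) * (n : ℝ) ^ (3 - 2 * s) := by nlinarith
  · have h2n : 2 ≤ n := by omega
    have hpt : ∀ x ∈ box 3 n \ box 3 2,
        tau 3 p 0 x ≤ 16 * C ^ 2 * ((Site.supNorm x : ℕ) : ℝ) ^ (-(2 * s)) := by
      intro x hx
      obtain ⟨-, hx2⟩ := Finset.mem_sdiff.1 hx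
      rw [mem_box_iff_supNorm_le, not_le] at hx2
      obtain ⟨i, hi⟩ := Site.exists_natAbs_eq_supNorm Finset.univ_nonempty x
      set k := Site.supNorm x with hk
      set m : ℕ := (k - 1) / 2 with hm
      have hm1 : 1 ≤ m := by omega
      have h2m : 2 * m + 1 ≤ k := by omega
      have hk4m : k ≤ 4 * m := by omega
      have hvi : 2 * (m : ℤ) + 1 ≤ |x i| := by
        rw [← Int.natCast_natAbs, hi]
        exact_mod_cast h2m
      have h1 := tau_le_oneArmProb_sq_of_coord m p i hvi
      have hπ := hC m hm1
      have hπ0 : 0 ≤ oneArmProb 3 p m := measureReal_nonneg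
      have hm0 : (0 : ℝ) < m := by exact_mod_cast hm1
      have hk0 : (0 : ℝ) < k := by exact_mod_cast (show 0 < k by omega)
      have hkm : (k : ℝ) / 4 ≤ m := by
        have : (k : ℝ) ≤ 4 * m := by exact_mod_cast hk4m
        linarith
      have hms : (m : ℝ) ^ (-s) ≤ 4 * (k : ℝ) ^ (-s) := by
        have h4s : (4 : ℝ) ^ s ≤ 4 := by
          calc (4 : ℝ) ^ s ≤ (4 : ℝ) ^ (1 : ℝ) :=
                Real.rpow_le_rpow_of_exponent_le (by norm_num) hs1
            _ = 4 := Real.rpow_one 4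
        calc (m : ℝ) ^ (-s) ≤ ((k : ℝ) / 4) ^ (-s) :=
              Real.rpow_le_rpow_of_nonpos (by positivity) hkm (by linarith)
          _ = (4 : ℝ) ^ s * (k : ℝ) ^ (-s) := by
              rw [Real.div_rpow hk0.le (by norm_num), Real.rpow_neg (by norm_num : (0 : ℝ) ≤ 4),
                Real.rpow_neg hk0.le]
              field_simp
          _ ≤ 4 * (k : ℝ) ^ (-s) :=
              mul_le_mul_of_nonneg_right h4s (Real.rpow_nonneg hk0.le _)
      have hkk : (k : ℝ) ^ (-s) * (k : ℝ) ^ (-s) = (k : ℝ) ^ (-(2 * s)) := by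
        rw [← Real.rpow_add hk0, show -s + -s = -(2 * s) by ring]
      calc tau 3 p 0 x ≤ oneArmProb 3 p m ^ 2 := h1
        _ ≤ (C * (m : ℝ) ^ (-s)) ^ 2 := pow_le_pow_left₀ hπ0 hπ 2
        _ = C ^ 2 * ((m : ℝ) ^ (-s)) ^ 2 := by ring
        _ ≤ C ^ 2 * (4 * (k : ℝ) ^ (-s)) ^ 2 :=
            mul_le_mul_of_nonneg_left (pow_le_pow_left₀ (Real.rpow_nonneg hm0.le _) hms 2) hC2
        _ = 16 * C ^ 2 * ((k : ℝ) ^ (-s) * (k : ℝ) ^ (-s)) := by ring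
        _ = 16 * C ^ 2 * (k : ℝ) ^ (-(2 * s)) := by rw [hkk]
    have hsplit : ∑ x ∈ box 3 n, tau 3 p 0 x =
        ∑ x ∈ box 3 n \ box 3 2, tau 3 p 0 x + ∑ x ∈ box 3 2, tau 3 p 0 x :=
      (Finset.sum_sdiff (box_mono 3 h2n)).symm
    have hshell : ∀ k ∈ Finset.Ico 2 n,
        ((sphere 3 (k + 1)).card : ℝ) * (((k + 1 : ℕ) : ℝ) ^ (-(2 * s))) ≤
          54 * (n : ℝ) ^ (2 - 2 * s) := by
      intro k hk
      have hkn : k + 1 ≤ n := (Finset.mem_Ico.1 hk).2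
      have hk1 : (0 : ℝ) < (k : ℝ) + 1 := by positivity
      have hkn' : (k : ℝ) + 1 ≤ n := by exact_mod_cast hkn
      have hcard : ((sphere 3 (k + 1)).card : ℝ) ≤ 54 * ((k : ℝ) + 1) ^ 2 := by
        have h := card_sphere_succ_le' (d := 3) (by norm_num) k
        norm_num at h
        linarith
      have hpow : ((k : ℝ) + 1) ^ 2 * ((k : ℝ) + 1) ^ (-(2 * s)) = ((k : ℝ) + 1) ^ (2 - 2 * s) := by
        rw [← Real.rpow_two, ← Real.rpow_add hk1, show (2 : ℝ) + -(2 * s) = 2 - 2 * s by ring]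
      push_cast
      calc ((sphere 3 (k + 1)).card : ℝ) * (((k : ℝ) + 1) ^ (-(2 * s)))
          ≤ 54 * ((k : ℝ) + 1) ^ 2 * (((k : ℝ) + 1) ^ (-(2 * s))) :=
            mul_le_mul_of_nonneg_right hcard (Real.rpow_nonneg hk1.le _)
        _ = 54 * ((k : ℝ) + 1) ^ (2 - 2 * s) := by rw [mul_assoc, hpow]
        _ ≤ 54 * (n : ℝ) ^ (2 - 2 * s) :=
            mul_le_mul_of_nonneg_left (Real.rpow_le_rpow hk1.le hkn' (by linarith)) (by norm_num)
    have hmul : (n : ℝ) * (n : ℝ) ^ (2 - 2 * s) = (n : ℝ) ^ (3 - 2 * s) := by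
      rw [show (3 : ℝ) - 2 * s = 1 + (2 - 2 * s) by ring, Real.rpow_add hn0, Real.rpow_one]
    have hann : ∑ x ∈ box 3 n \ box 3 2, tau 3 p 0 x ≤ 16 * C ^ 2 * (54 * (n : ℝ) ^ (3 - 2 * s)) := by
      calc ∑ x ∈ box 3 n \ box 3 2, tau 3 p 0 x
          ≤ ∑ x ∈ box 3 n \ box 3 2, 16 * C ^ 2 * ((Site.supNorm x : ℕ) : ℝ) ^ (-(2 * s)) :=
            Finset.sum_le_sum hpt
        _ = 16 * C ^ 2 *
              ∑ x ∈ box 3 n \ box 3 2, (fun k : ℕ => (k : ℝ) ^ (-(2 * s))) (Site.supNorm x) := by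
            rw [Finset.mul_sum]
        _ = 16 * C ^ 2 * ∑ k ∈ Finset.Ico 2 n,
              ((sphere 3 (k + 1)).card : ℝ) * (((k + 1 : ℕ) : ℝ) ^ (-(2 * s))) := by
            rw [sum_box_sdiff_box_eq_sum_Ico (fun k : ℕ => (k : ℝ) ^ (-(2 * s))) h2n]
        _ ≤ 16 * C ^ 2 * ∑ _k ∈ Finset.Ico 2 n, 54 * (n : ℝ) ^ (2 - 2 * s) :=
            mul_le_mul_of_nonneg_left (Finset.sum_le_sum hshell) (by positivity)
        _ = 16 * C ^ 2 * (((n - 2 : ℕ) : ℝ) * (54 * (n : ℝ) ^ (2 - 2 * s))) := by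
            rw [Finset.sum_const, Nat.card_Ico, nsmul_eq_mul]
        _ ≤ 16 * C ^ 2 * ((n : ℝ) * (54 * (n : ℝ) ^ (2 - 2 * s))) := by
            gcongr
            exact_mod_cast Nat.sub_le n 2
        _ = 16 * C ^ 2 * (54 * ((n : ℝ) * (n : ℝ) ^ (2 - 2 * s))) := by ring
        _ = 16 * C ^ 2 * (54 * (n : ℝ) ^ (3 - 2 * s)) := by rw [hmul]
    calc ∑ x ∈ box 3 n, tau 3 p 0 x
        = ∑ x ∈ box 3 n \ box 3 2, tau 3 p 0 x + ∑ x ∈ box 3 2, tau 3 p 0 x := hsplit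
      _ ≤ 16 * C ^ 2 * (54 * (n : ℝ) ^ (3 - 2 * s)) + 125 := add_le_add hann (hsmall 2 le_rfl)
      _ ≤ 16 * C ^ 2 * (54 * (n : ℝ) ^ (3 - 2 * s)) + 125 * (n : ℝ) ^ (3 - 2 * s) := by nlinarith
      _ = (125 + 864 * C ^ 2) * (n : ℝ) ^ (3 - 2 * s) := by ring

/-! ## One-arm decay ⟹ power saving of the free-box pair average, exponent `2s` -/

/-- **One-arm decay ⟹ power saving with exponent `2s`**: if `π_p(m) ≤ C m^{-s}` (`m ≥ 1`,
`0 < s ≤ 1`) then `FA₂(p, n) ≤ 8 (125 + 864 C²) n^{-2s}` for all `n ≥ 1`. [folklore] -/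
theorem fa2_le_of_oneArm (p : unitInterval) {C s : ℝ} (hs0 : 0 < s) (hs1 : s ≤ 1)
    (hC : ∀ m : ℕ, 1 ≤ m → oneArmProb 3 p m ≤ C * (m : ℝ) ^ (-s)) {n : ℕ} (hn : 1 ≤ n) :
    fa2 p n ≤ 8 * (125 + 864 * C ^ 2) * (n : ℝ) ^ (-(2 * s)) := by
  have hnpos : (0 : ℝ) < n := by exact_mod_cast hn
  have hn2 : 1 ≤ 2 * n := by omega
  have hsum := sum_tau_box_le_of_oneArm_rpow p hs0 hs1 hC hn2
  have hK : 0 ≤ 125 + 864 * C ^ 2 := by positivity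
  have hcard : (n : ℝ) ^ 3 ≤ ((box 3 n).card : ℝ) := by
    rw [card_box_real]
    have : (n : ℝ) ≤ 2 * n + 1 := by linarith
    calc (n : ℝ) ^ 3 ≤ (2 * (n : ℝ) + 1) ^ 3 := by gcongr
      _ = _ := by ring
  have hc := card_box_pos n
  have h2pow : ((2 * n : ℕ) : ℝ) ^ (3 - 2 * s) ≤ 8 * ((n : ℝ) ^ (-(2 * s)) * (n : ℝ) ^ 3) := by
    push_cast
    rw [Real.mul_rpow (by norm_num) hnpos.le]
    have h8 : (2 : ℝ) ^ (3 - 2 * s) ≤ 8 := by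
      calc (2 : ℝ) ^ (3 - 2 * s) ≤ (2 : ℝ) ^ (3 : ℝ) :=
            Real.rpow_le_rpow_of_exponent_le (by norm_num) (by linarith)
        _ = 8 := by norm_num
    have hn3 : (n : ℝ) ^ (3 - 2 * s) = (n : ℝ) ^ (-(2 * s)) * (n : ℝ) ^ 3 := by
      rw [← Real.rpow_natCast (n : ℝ) 3, ← Real.rpow_add hnpos]
      congr 1
      push_cast
      ring
    rw [hn3]
    exact mul_le_mul_of_nonneg_right h8 (by positivity)
  unfold fa2
  rw [div_le_iff₀ (pow_pos hc 2)]
  calc pairSum p n ≤ ((box 3 n).card : ℝ) * ∑ z ∈ box 3 (2 * n), tau 3 p 0 z :=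
        pairSum_le_card_mul_sum_tau p n
    _ ≤ ((box 3 n).card : ℝ) * ((125 + 864 * C ^ 2) * ((2 * n : ℕ) : ℝ) ^ (3 - 2 * s)) :=
        mul_le_mul_of_nonneg_left hsum hc.le
    _ ≤ ((box 3 n).card : ℝ) * ((125 + 864 * C ^ 2) * (8 * ((n : ℝ) ^ (-(2 * s)) * (n : ℝ) ^ 3))) :=
        mul_le_mul_of_nonneg_left (mul_le_mul_of_nonneg_left h2pow hK) hc.le
    _ = 8 * (125 + 864 * C ^ 2) * (n : ℝ) ^ (-(2 * s)) * ((n : ℝ) ^ 3 * ((box 3 n).card : ℝ)) := by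
        ring
    _ ≤ 8 * (125 + 864 * C ^ 2) * (n : ℝ) ^ (-(2 * s)) *
          (((box 3 n).card : ℝ) * ((box 3 n).card : ℝ)) := by
        have hpos : 0 ≤ 8 * (125 + 864 * C ^ 2) * (n : ℝ) ^ (-(2 * s)) := by positivity
        exact mul_le_mul_of_nonneg_left (mul_le_mul_of_nonneg_right hcard hc.le) hpos
    _ = 8 * (125 + 864 * C ^ 2) * (n : ℝ) ^ (-(2 * s)) * ((box 3 n).card : ℝ) ^ 2 := by ring

/-- Any positive one-arm exponent at `p` gives a power saving at `p` (exponent `2 min(s,1)`). [folklore] -/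
theorem exists_powerSaving_of_oneArm (p : unitInterval) {C s : ℝ} (hs0 : 0 < s)
    (hC : ∀ m : ℕ, 1 ≤ m → oneArmProb 3 p m ≤ C * (m : ℝ) ^ (-s)) :
    ∃ a C' : ℝ, 0 < a ∧ ∀ n : ℕ, 1 ≤ n → fa2 p n ≤ C' * (n : ℝ) ^ (-a) := by
  have hs' : 0 < min s 1 := lt_min hs0 one_pos
  refine ⟨2 * min s 1, 8 * (125 + 864 * (max C 0) ^ 2), by linarith, fun n hn => ?_⟩
  refine fa2_le_of_oneArm p (C := max C 0) hs' (min_le_right _ _) (fun m hm => ?_) hn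
  have hm1 : (1 : ℝ) ≤ m := by exact_mod_cast hm
  calc oneArmProb 3 p m ≤ C * (m : ℝ) ^ (-s) := hC m hm
    _ ≤ max C 0 * (m : ℝ) ^ (-s) :=
        mul_le_mul_of_nonneg_right (le_max_left _ _) (Real.rpow_nonneg (by positivity) _)
    _ ≤ max C 0 * (m : ℝ) ^ (-min s 1) :=
        mul_le_mul_of_nonneg_left
          (Real.rpow_le_rpow_of_exponent_le hm1 (neg_le_neg (min_le_left s 1))) (le_max_right _ _)

/-- **Polynomial one-arm decay at `p_c(ℤ³)` implies the crux** (with `a = 2 min(s,1)`; the predicted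
`s = β/ν ≈ 0.477` gives the sharp `a = 1 + η ≈ 0.954`). [folklore] -/
theorem of_oneArm_decay {s C : ℝ} (hs : 0 < s)
    (hC : ∀ m : ℕ, 1 ≤ m → oneArmProb 3 (criticalProbI 3) m ≤ C * (m : ℝ) ^ (-s)) :
    FreeBoxPowerSaving :=
  freeBoxPowerSaving_iff_fa2.2 (exists_powerSaving_of_oneArm _ hs hC)

/-- **What a refutation of the crux entails**: `¬ FreeBoxPowerSaving` forces the critical one-arm
probability of `ℤ³` to decay slower than every power, `∀ s > 0, ∀ C, ∃ m ≥ 1, π_{p_c}(m) > C m^{-s}`.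
[folklore] -/
theorem forall_exists_oneArmProb_gt_of_not (h : ¬ FreeBoxPowerSaving) :
    ∀ s C : ℝ, 0 < s → ∃ m : ℕ, 1 ≤ m ∧ C * (m : ℝ) ^ (-s) < oneArmProb 3 (criticalProbI 3) m := by
  intro s C hs
  by_contra hcon
  push Not at hcon
  exact h (of_oneArm_decay hs hcon)

/-! ## The one-arm floor at `p_c(ℤ³)` and the tightness `s ≤ 1` -/

/-- **The classical one-arm floor at `p_c(ℤ³)`**, squared form: `π_{p_c}(m)² ≥ 1/(36 (4m+3)²)`.
The Kozma–Nachmias Lemma 3.1 sphere sum `Σ_{z ∈ ∂Λ_{2m+1}} P_{p_c}(0 ↔ z in Λ_{2m+1}) ≥ 1/6` (tree,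
`sum_sphere_real_openConnIn_ge`, from `φ_{p_c} ≥ 1`, Duminil-Copin–Tassion) has
`|∂Λ_{2m+1}| ≤ 6 (4m+3)²` terms, each `≤ τ_{p_c}(0, z) ≤ π_{p_c}(m)²` by two disjoint boxes. [folklore] -/
theorem oneArmProb_criticalProbI_sq_ge (m : ℕ) :
    1 / (36 * (4 * (m : ℝ) + 3) ^ 2) ≤ oneArmProb 3 (criticalProbI 3) m ^ 2 := by
  set π : ℝ := oneArmProb 3 (criticalProbI 3) m with hπ
  have hsum := sum_sphere_real_openConnIn_ge (d := 3) (by norm_num) (criticalProbI 3) le_rfl (2 * m + 1)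
  have hterm : ∀ z ∈ sphere 3 (2 * m + 1),
      (bondPercolation (zdGraph 3) (criticalProbI 3)).real
        (openConnIn (↑(box 3 (2 * m + 1)) : Set (Site 3)) 0 z) ≤ π ^ 2 := by
    intro z hz
    have hk : Site.supNorm z = 2 * m + 1 := mem_sphere.1 hz
    obtain ⟨i, hi⟩ := Site.exists_natAbs_eq_supNorm Finset.univ_nonempty z
    have hvi : 2 * (m : ℤ) + 1 ≤ |z i| := by
      rw [← Int.natCast_natAbs, hi, hk]
      push_cast
      exact le_rfl
    exact (real_openConnIn_le_tau _ _ 0 z).trans (tau_le_oneArmProb_sq_of_coord m _ i hvi)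
  have hcard : ((sphere 3 (2 * m + 1)).card : ℝ) ≤ 6 * (4 * (m : ℝ) + 3) ^ 2 := by
    have h := card_sphere_succ_le (d := 3) (2 * m)
    norm_num at h
    calc ((sphere 3 (2 * m + 1)).card : ℝ) ≤ 6 * (2 * (2 * (m : ℝ)) + 3) ^ 2 := by linarith
      _ = 6 * (4 * (m : ℝ) + 3) ^ 2 := by ring
  have h6 : 1 / 6 ≤ ((sphere 3 (2 * m + 1)).card : ℝ) * π ^ 2 := by
    have h1 : (1 : ℝ) / (2 * (3 : ℕ)) = 1 / 6 := by norm_num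
    rw [← h1]
    calc _ ≤ _ := hsum
      _ ≤ ∑ _z ∈ sphere 3 (2 * m + 1), π ^ 2 := Finset.sum_le_sum hterm
      _ = _ := by rw [Finset.sum_const, nsmul_eq_mul]
  have hπ2 : 0 ≤ π ^ 2 := sq_nonneg π
  have hpos : (0 : ℝ) < 36 * (4 * (m : ℝ) + 3) ^ 2 := by positivity
  rw [div_le_iff₀ hpos]
  nlinarith

/-- Hence **`π_{p_c}(m) ≥ 1/(6(4m+3))`** on `ℤ³` (`≥ 1/(42 m)` for `m ≥ 1`): the `m^{-(d-1)/2}` floor at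
`d = 3` (the tree's input-free `exists_oneArmProb_criticalProbI_lower_sq` is `c/m²`). [folklore] -/
theorem oneArmProb_criticalProbI_ge (m : ℕ) :
    1 / (6 * (4 * (m : ℝ) + 3)) ≤ oneArmProb 3 (criticalProbI 3) m := by
  have h := oneArmProb_criticalProbI_sq_ge m
  have hπ0 : 0 ≤ oneArmProb 3 (criticalProbI 3) m := measureReal_nonneg
  have hsq : (1 / (6 * (4 * (m : ℝ) + 3))) ^ 2 ≤ oneArmProb 3 (criticalProbI 3) m ^ 2 := by
    calc (1 / (6 * (4 * (m : ℝ) + 3))) ^ 2 = 1 / (36 * (4 * (m : ℝ) + 3) ^ 2) := by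
          rw [div_pow, one_pow, mul_pow]; norm_num
      _ ≤ _ := h
  exact (pow_le_pow_iff_left₀ (by positivity) hπ0 two_ne_zero).1 hsq

/-- **Tightness of the one-arm exponent at `p_c(ℤ³)`**: a bound `π_{p_c}(m) ≤ C m^{-s}` (`m ≥ 1`) has
`s ≤ 1`; so the one-arm route (`fa2_le_of_oneArm`, exponent `2s`) never beats the ceiling `a ≤ 2`.
[folklore] -/
theorem oneArm_exponent_le_one {C s : ℝ}
    (hC : ∀ m : ℕ, 1 ≤ m → oneArmProb 3 (criticalProbI 3) m ≤ C * (m : ℝ) ^ (-s)) : s ≤ 1 := by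
  by_contra hs
  push Not at hs
  have hs1 : 0 < s - 1 := by linarith
  have hev : ∀ᶠ m : ℕ in atTop, 42 * C < (m : ℝ) ^ (s - 1) :=
    ((tendsto_rpow_atTop hs1).comp tendsto_natCast_atTop_atTop).eventually_gt_atTop _
  obtain ⟨m, hmC, hm1⟩ := (hev.and (eventually_ge_atTop 1)).exists
  have hmpos : (0 : ℝ) < m := by exact_mod_cast hm1
  have hm1' : (1 : ℝ) ≤ m := by exact_mod_cast hm1
  have hlow : 1 / (42 * (m : ℝ)) ≤ oneArmProb 3 (criticalProbI 3) m := by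
    refine le_trans ?_ (oneArmProb_criticalProbI_ge m)
    exact one_div_le_one_div_of_le (by positivity) (by nlinarith)
  have key : 1 / (42 * (m : ℝ)) ≤ C * (m : ℝ) ^ (-s) := hlow.trans (hC m hm1)
  have hms : 0 < (m : ℝ) ^ s := Real.rpow_pos_of_pos hmpos s
  rw [Real.rpow_neg hmpos.le, ← div_eq_mul_inv, le_div_iff₀ hms] at key
  have h2 : (m : ℝ) ^ (s - 1) = 42 * (1 / (42 * (m : ℝ)) * (m : ℝ) ^ s) := by
    rw [Real.rpow_sub hmpos, Real.rpow_one]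
    field_simp
  rw [h2] at hmC
  linarith

end

end Summit.CriticalPhenomena.PercolationContinuityZ3.FreeBoxPowerSavingNegative
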